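import Summits.HodgeConjecture.HodgeConjecture.Theorems.MarkmanPartnerTransportPicardThreeK3SquaresResidueSqrtThree
import Summits.HodgeConjecture.HodgeConjecture.Theorems.MarkmanPartnerTransportPicardThreeK3SquaresSqrtSix

/-!
# Route MarkmanPartnerTransport · crux `PicardThreeK3Squares` (stmt-HodgeConjecture-19652) —
# the residue after the `√2`- (`ρ ≥ 12`), `√3`- (`ρ ≥ 15`) and `√6`-sectors (`ρ ≥ 15`)

`Theorems/…ResidueSqrtThree` (gen 4) pins the crux, modulo seven named facts, to the cycle-induced sector
clause on the non-CM, non-scalar projective K3 surfaces with `ρ(S) ≥ 3`, `22 − ρ(S) = e·m`, off the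
Kuga–Satake sector, without `√2`-multiplication at `ρ ≥ 12` and without `√3`-multiplication at `ρ ≥ 15`.
`Theorems/…SqrtSix` (gen 4, a sector NOT in print) proves HC for `S ⊗ S` — modulo Buskin, markings,
`Varesco2023_quotientSimilitude_{two,three}_of_transcendental_embedding` and
`Huybrechts2019_transcendentalHodgeIsometry_algebraic` — for every projective K3 surface with
`ρ(S) ≥ 15` carrying a rational Hodge endomorphism `ψ` with `ψ² = 6` and multiplier `6` on `T(S)`. This
file subtracts it too:

* `picardThreeK3Squares_of_residue_sqrtSix` / `picardThreeK3Squares_iff_residue_sqrtSix` — **modulo the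
  ten named facts, `PicardThreeK3Squares` is EQUIVALENT to the cycle-induced sector clause on the non-CM,
  non-scalar projective K3 surfaces `S` with `ρ(S) ≥ 3`, `22 − ρ(S) = e·m` (`e ≥ 2`, `m ≥ 3`),
  `T(S)_ℚ ≇ U_ℚ² ⊕ ⟨a⟩ ⊕ ⟨b⟩`, WITHOUT `√2`-multiplication when `ρ(S) ≥ 12`, WITHOUT `√3`- and WITHOUT
  `√6`-multiplication when `ρ(S) ≥ 15`.** The exact open content of item stmt-HodgeConjecture-19652
  after gen 0–4 of the prover lane, as one kernel statement.

No definition, no sorry; named facts only as hypotheses. Prover seat hodge-nonav-19652-p1 (gen 4),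
`--supports stmt-HodgeConjecture-19652`.

References: Varesco, Math. Z. 305 (2023) §2; Huybrechts, Comment. Math. Helv. 94 (2019) Cor. 0.4; van
Geemen–Sarti, Math. Z. 255 (2007) Prop. 2.3; Floccari, Geom. Topol. 30 (2026) Thm. 5.11; Buskin, J. reine
angew. Math. 755 (2019) Thm. 1.1.
-/

set_option linter.dupNamespace false

noncomputable section

namespace Summit.HodgeConjecture.HodgeConjecture.Theorems.MarkmanPartnerTransport.Residue

open scoped Manifold
open CategoryTheory MonoidalCategory CartesianMonoidalCategory
open Literature.AlgebraicGeometry Literature.AlgebraicGeometry.Motives Literature.AlgebraicGeometry.HodgeTheory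
open Literature.AlgebraicGeometry.Surfaces
open Literature.AlgebraicTopology.SingularHomology
open Summit.HodgeConjecture.HodgeConjecture.Theorems
open Summit.HodgeConjecture.HodgeConjecture.Theorems.MarkmanPartnerTransport

/-- `Corr[μ, hS ; γ, y] = pr₁_*(pr₂^* y ∪ γ)` on `H²(S(ℂ); ℂ)`. Local notation only. -/
local notation3 (prettyPrint := false) "Corr[" μ ", " hS " ; " γ ", " y "]" =>
  complexGysin μ (IsSmoothProjective.tensor_holds hS hS) hS
    (SemiCartesianMonoidalCategory.fst _ _) (rfl : 2 * 1 + 2 * 2 + 2 * 2 = 2 * 1 + 2 * (2 + 2))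
    (cupProduct (rfl : 2 * 1 + 2 * 2 = 2 * 1 + 2 * 2)
      (complexBetti.map (SemiCartesianMonoidalCategory.snd _ _) (2 * 1) y) γ)

/-- `NoSqrtTwo[S]`: `S` carries NO real multiplication by `√2` at Picard rank `≥ 12` — every rational,
Hodge-type-preserving endomorphism `ψ` of `H²(S(ℂ); ℂ)` with `ψ² = 2` and multiplier `2` on `T(S)`
forces `ρ(S) < 12` (the complement of the sector of
`NikulinIsogeny.hodgeConjectureFor_square_of_twelve_le_of_sqrtTwo'`). Local notation only. -/
local notation3 (prettyPrint := false) "NoSqrtTwo[" S "]" =>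
  (∀ ψ : complexBetti S (2 * 1) →ₗ[ℂ] complexBetti S (2 * 1),
    (∀ y, IsRationalClass y → IsRationalClass (ψ y)) →
    (∀ (i j : ℕ) y, IsOfHodgeType 2 S (2 * 1) i j y → IsOfHodgeType 2 S (2 * 1) i j (ψ y)) →
    (∀ y ∈ transcendentalSubspace S, ψ (ψ y) = (2 : ℂ) • y) →
    (∀ y ∈ transcendentalSubspace S, ∀ z ∈ transcendentalSubspace S,
      cupProduct (rfl : 2 * 1 + 2 * 1 = 2 * 2) (ψ y) (ψ z) =
        (2 : ℂ) • cupProduct (rfl : 2 * 1 + 2 * 1 = 2 * 2) y z) →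
    Module.finrank ℂ ↥(algebraicClasses S 1) < 12)

/-- `NoSqrtThree[S]`: `S` carries NO real multiplication by `√3` at Picard rank `≥ 15` — every
rational, Hodge-type-preserving endomorphism `ψ` of `H²(S(ℂ); ℂ)` with `ψ² = 3` and multiplier `3` on
`T(S)` forces `ρ(S) < 15` (the complement of the sector of
`NikulinIsogeny.hodgeConjectureFor_square_of_fifteen_le_of_sqrtThree'`). Local notation only. -/
local notation3 (prettyPrint := false) "NoSqrtThree[" S "]" =>
  (∀ ψ : complexBetti S (2 * 1) →ₗ[ℂ] complexBetti S (2 * 1),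
    (∀ y, IsRationalClass y → IsRationalClass (ψ y)) →
    (∀ (i j : ℕ) y, IsOfHodgeType 2 S (2 * 1) i j y → IsOfHodgeType 2 S (2 * 1) i j (ψ y)) →
    (∀ y ∈ transcendentalSubspace S, ψ (ψ y) = (3 : ℂ) • y) →
    (∀ y ∈ transcendentalSubspace S, ∀ z ∈ transcendentalSubspace S,
      cupProduct (rfl : 2 * 1 + 2 * 1 = 2 * 2) (ψ y) (ψ z) =
        (3 : ℂ) • cupProduct (rfl : 2 * 1 + 2 * 1 = 2 * 2) y z) →
    Module.finrank ℂ ↥(algebraicClasses S 1) < 15)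

/-- `NoSqrtSix[S]`: `S` carries NO real multiplication by `√6` at Picard rank `≥ 15`. Local notation only. -/
local notation3 (prettyPrint := false) "NoSqrtSix[" S "]" =>
  (∀ ψ : complexBetti S (2 * 1) →ₗ[ℂ] complexBetti S (2 * 1),
    (∀ y, IsRationalClass y → IsRationalClass (ψ y)) →
    (∀ (i j : ℕ) y, IsOfHodgeType 2 S (2 * 1) i j y → IsOfHodgeType 2 S (2 * 1) i j (ψ y)) →
    (∀ y ∈ transcendentalSubspace S, ψ (ψ y) = (6 : ℂ) • y) →
    (∀ y ∈ transcendentalSubspace S, ∀ z ∈ transcendentalSubspace S,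
      cupProduct (rfl : 2 * 1 + 2 * 1 = 2 * 2) (ψ y) (ψ z) =
        (6 : ℂ) • cupProduct (rfl : 2 * 1 + 2 * 1 = 2 * 2) y z) →
    Module.finrank ℂ ↥(algebraicClasses S 1) < 15)

/-- `OpenClause[S, hS]`: the cycle-induced sector clause for `S` (for the complex orientation family),
under the hypothesis that `End_Hdg(T(S))` is not `ℚ` — VERBATIM the last two binders of
`Residue.picardThreeK3Squares_iff_residue`. Local notation only. -/
local notation3 (prettyPrint := false) "OpenClause[" S ", " hS "]" =>
  ((¬ ∀ (f : complexBetti S (2 * 1) →ₗ[ℂ] complexBetti S (2 * 1)),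
      (∀ y, IsRationalClass y → IsRationalClass (f y)) →
      (∀ (i j : ℕ) y, IsOfHodgeType 2 S (2 * 1) i j y → IsOfHodgeType 2 S (2 * 1) i j (f y)) →
      (∀ d ∈ algebraicClasses S 1, f d = 0) →
      (∀ y : complexBetti S (2 * 1), ∀ d ∈ algebraicClasses S 1,
        cupProduct (rfl : 2 * 1 + 2 * 1 = 2 * 2) (f y) d = 0) →
      ∃ a : ℚ, ∀ y : complexBetti S (2 * 1),
        (∀ d ∈ algebraicClasses S 1, cupProduct (rfl : 2 * 1 + 2 * 1 = 2 * 2) y d = 0) →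
          f y = (a : ℂ) • y) →
    ∀ (f : complexBetti S (2 * 1) →ₗ[ℂ] complexBetti S (2 * 1)),
      (∀ y, IsRationalClass y → IsRationalClass (f y)) →
      (∀ (i j : ℕ) y, IsOfHodgeType 2 S (2 * 1) i j y → IsOfHodgeType 2 S (2 * 1) i j (f y)) →
      (∀ d ∈ algebraicClasses S 1, f d = 0) →
      (∀ y : complexBetti S (2 * 1), ∀ d ∈ algebraicClasses S 1,
        cupProduct (rfl : 2 * 1 + 2 * 1 = 2 * 2) (f y) d = 0) →
      ∃ g : complexBetti S (2 * 1) →ₗ[ℂ] complexBetti S (2 * 1),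
        (∀ d ∈ algebraicClasses S 1, g d ∈ algebraicClasses S 1) ∧
        (∃ γ ∈ algebraicClasses (S ⊗ S) 2, ∀ y : complexBetti S (2 * 1),
          g y = Corr[complexOrientationFamily, IsK3Surface.isSmoothProjective hS ; γ, y]) ∧
        ∀ y : complexBetti S (2 * 1),
          (∀ d ∈ algebraicClasses S 1, cupProduct (rfl : 2 * 1 + 2 * 1 = 2 * 2) y d = 0) →
            f y = g y)

/-- **The crux from the cycle-induced sector clause on the RESIDUE AFTER THE `√2`-, `√3`- AND
`√6`-SECTORS** (modulo the ten named facts). On the newly subtracted sector HC for `S ⊗ S` holds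
(`SqrtSix.hodgeConjectureFor_square_of_fifteen_le_of_sqrtSix'`) and implies the clause
(`SectorIff.cycleInducedSector_of_hodgeConjectureFor_square`); the rest is
`picardThreeK3Squares_of_residue_sqrtTwo_sqrtThree`. [cite: Varesco2023, §2 (p. 8), Prop. 2.5 and Prop. 2.11]
[cite: Huybrechts2019, Cor. 0.4 (i)] [cite: Floccari2026, Thm. 5.11 (§5)] [cite: Buskin2019, Thm. 1.1] -/
theorem picardThreeK3Squares_of_residue_sqrtSix (hB : Buskin2019_hodgeIsometry_algebraic)
    (hmark : Huybrechts_K3_marking_exists)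
    (hF : Floccari2026_hodgeClasses_algebraic_powers_of_K3_of_transcendental_embedding)
    (hPS : Huybrechts_K3_periodSurjective_projective)
    (hV : Varesco2023_sqrtMultiplication_algebraic_of_symplecticAutomorphism)
    (hGS : VanGeemenSarti2007_nikulinInvolution_of_primitiveE8)
    (hV3 : Varesco2023_sqrtThree_algebraic_of_transcendental_embedding)
    (hQ2 : Varesco2023_quotientSimilitude_two_of_transcendental_embedding)
    (hQ3 : Varesco2023_quotientSimilitude_three_of_transcendental_embedding)
    (hH : Huybrechts2019_transcendentalHodgeIsometry_algebraic)
    (hRM : ∀ (S : SchemeOver ℂ) (hS : IsK3Surface S), ¬ HasComplexMultiplication S →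
      3 ≤ Module.finrank ℂ ↥(algebraicClasses S 1) →
      (∃ e m : ℕ, 2 ≤ e ∧ 3 ≤ m ∧ e * m + Module.finrank ℂ ↥(algebraicClasses S 1) = 22) →
      (∀ a b : ℤ, a < 0 → b < 0 → ¬ HasTranscendentalLatticeU2ab S a b) →
      NoSqrtTwo[S] → NoSqrtThree[S] → NoSqrtSix[S] → OpenClause[S, hS]) :
    Summit.HodgeConjecture.HodgeConjecture.Theses.MarkmanPartnerTransport.PicardThreeK3Squares :=
  picardThreeK3Squares_of_residue_sqrtTwo_sqrtThree hB hmark hF hPS hV hGS hV3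
    fun S hS hCM h3 hem hU2 hN2 hN3 hQ => by
    by_cases hψ : ∃ ψ : complexBetti S (2 * 1) →ₗ[ℂ] complexBetti S (2 * 1),
        (∀ y, IsRationalClass y → IsRationalClass (ψ y)) ∧
        (∀ (i j : ℕ) y, IsOfHodgeType 2 S (2 * 1) i j y → IsOfHodgeType 2 S (2 * 1) i j (ψ y)) ∧
        (∀ y ∈ transcendentalSubspace S, ψ (ψ y) = (6 : ℂ) • y) ∧
        (∀ y ∈ transcendentalSubspace S, ∀ z ∈ transcendentalSubspace S,
          cupProduct (rfl : 2 * 1 + 2 * 1 = 2 * 2) (ψ y) (ψ z) =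
            (6 : ℂ) • cupProduct (rfl : 2 * 1 + 2 * 1 = 2 * 2) y z) ∧
        15 ≤ Module.finrank ℂ ↥(algebraicClasses S 1)
    · obtain ⟨ψ, hψrat, hψtyp, hψsq, hψmul, hρ⟩ := hψ
      exact SectorIff.cycleInducedSector_of_hodgeConjectureFor_square complexOrientationFamily
        hS.isSmoothProjective
        (SqrtSix.hodgeConjectureFor_square_of_fifteen_le_of_sqrtSix' hB hmark hQ2 hQ3 hH hS hρ ψ
          hψrat hψtyp hψsq hψmul)
    · push Not at hψ
      exact hRM S hS hCM h3 hem hU2 hN2 hN3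
        (fun ψ hψrat hψtyp hψsq hψmul => hψ ψ hψrat hψtyp hψsq hψmul) hQ

/-- **The crux is EQUIVALENT to the clause on the residue after the `√2`-, `√3`- and `√6`-sectors**
(modulo the ten named facts). What is left of item stmt-HodgeConjecture-19652 after gen 0–4 of the prover
lane: the real-multiplication K3 surfaces with `ρ ∈ {4, 6, 7, 8, 10, 13}`, those with `ρ ∈ {12, 14}`
without `√2`-multiplication, and those with `ρ = 16`, `T(S)_ℚ` of Witt index `1`, with real
multiplication by `ℚ(√d)`, `d ∉ {2, 3, 6}`. [cite: Varesco2023, §2 (p. 8)] [cite: GeemenSchutt2023, §2.1]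
[cite: Huybrechts2019, Cor. 0.4 (i)] [cite: Floccari2026, Thm. 5.11 (§5)] -/
theorem picardThreeK3Squares_iff_residue_sqrtSix (hB : Buskin2019_hodgeIsometry_algebraic)
    (hmark : Huybrechts_K3_marking_exists)
    (hF : Floccari2026_hodgeClasses_algebraic_powers_of_K3_of_transcendental_embedding)
    (hPS : Huybrechts_K3_periodSurjective_projective)
    (hV : Varesco2023_sqrtMultiplication_algebraic_of_symplecticAutomorphism)
    (hGS : VanGeemenSarti2007_nikulinInvolution_of_primitiveE8)
    (hV3 : Varesco2023_sqrtThree_algebraic_of_transcendental_embedding)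
    (hQ2 : Varesco2023_quotientSimilitude_two_of_transcendental_embedding)
    (hQ3 : Varesco2023_quotientSimilitude_three_of_transcendental_embedding)
    (hH : Huybrechts2019_transcendentalHodgeIsometry_algebraic) :
    Summit.HodgeConjecture.HodgeConjecture.Theses.MarkmanPartnerTransport.PicardThreeK3Squares ↔
    ∀ (S : SchemeOver ℂ) (hS : IsK3Surface S), ¬ HasComplexMultiplication S →
      3 ≤ Module.finrank ℂ ↥(algebraicClasses S 1) →
      (∃ e m : ℕ, 2 ≤ e ∧ 3 ≤ m ∧ e * m + Module.finrank ℂ ↥(algebraicClasses S 1) = 22) →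
      (∀ a b : ℤ, a < 0 → b < 0 → ¬ HasTranscendentalLatticeU2ab S a b) →
      NoSqrtTwo[S] → NoSqrtThree[S] → NoSqrtSix[S] → OpenClause[S, hS] :=
  ⟨fun h S hS _ h3 _ _ _ _ _ _ =>
    SectorIff.cycleInducedSector_of_picardThreeK3Squares h hmark complexOrientationFamily S hS h3,
   fun h => picardThreeK3Squares_of_residue_sqrtSix hB hmark hF hPS hV hGS hV3 hQ2 hQ3 hH h⟩

end Summit.HodgeConjecture.HodgeConjecture.Theorems.MarkmanPartnerTransport.Residue

end
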